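import Mathlib
import Literature.NumberTheory.Transcendental.KZLogCalculusProofs
import Literature.NumberTheory.Transcendental.SemialgebraicDerivative
import Literature.NumberTheory.Transcendental.SemialgebraicDerivativeProofs
import Summits.KontsevichZagierPeriods.KontsevichZagierPeriods.Theses.LiouvilleUnfolding

/-!
# Sketch (crux-ideate, ideator 2) — crux `UnfoldedLogStokes` (stmt-KontsevichZagierPeriods-2835)

**STATUS (2026-08-16T01:10Z): this file contains a CANDIDATE FULL PROOF of the crux**,
`unfoldedLogStokes_holds : Summit.KontsevichZagierPeriods.KontsevichZagierPeriods.Theses.LiouvilleUnfolding.UnfoldedLogStokes`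
(`lean check` rc 0, 0 sorries, axioms `propext / Classical.choice / Quot.sound`; H21 audit class
`proof-of-item, closed`). A planner cannot land `Theorems/`; the lead prover should copy the
declarations below (namespace renamed) into
`Summits/KontsevichZagierPeriods/KontsevichZagierPeriods/Theorems/UnfoldedLogStokes.lean` and propose it
against item stmt-KontsevichZagierPeriods-2835.

Structure = the two idea cards of ideator 2 composed:
* card `integrand-borne-velocities`: `EngineOfReps` (the θ-box engine in REPRESENTATION form) and the
  dictionary `unfoldedLogStokes_of_engineOfReps : EngineOfReps → UnfoldedLogStokes`
  (`H″ := r₁.integrand (·, 1)`, `P := r₄.integrand · V`, `Ua := r₃.neg`);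
* card `definable-velocity-verbatim-engine`: `engineOfReps_holds`, from the PROVED tree engine
  `KZ.unfoldedLogStokes_mem_relations` applied verbatim after `velocityExtension_holds`
  (BPR Prop. 3.22 in tree + zero extension), `nullNormalise_holds` (rule 1a off a null semialgebraic
  set) and `defoldIntegrable_holds` (Tonelli: unfolded integrable ⇒ `h log v ∈ L¹`).
All statements are over existing declarations only (`KZ.IntegralRep`, `KZ.of`, `KZ.relations`,
`KZlog.band`, `IsSemialgebraicFunOn`, `Literature.ModelTheory.ExponentialFields.IsSemialgebraic`).
-/

noncomputable section

open MeasureTheory Set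
open Literature.NumberTheory.Transcendental
open Literature.ModelTheory.ExponentialFields (IsSemialgebraic)

namespace Summit.KontsevichZagierPeriods.KontsevichZagierPeriods.Cruxes.UnfoldedLogStokes.Ideator2

/-- **Card A — first lemma / transfer `C⁺` (engine in representation form).**
The θ-box engine `KZ.unfoldedLogStokes_mem_relations` re-run with a single semialgebraic `P` in
place of the product `H · V'` and with the unfolded monomial `W` pinned only over the OPEN band:
no semialgebraicity of `V'`, no integrability hypotheses (they are defolded from the four
representations), no normalisation of `RB`, `W`. -/
def EngineOfReps : Prop :=
  ∀ (n : ℕ) (τ : Set (Fin n → ℝ)) (a b : (Fin n → ℝ) → ℝ) (H H' V V' P : (Fin (n + 1) → ℝ) → ℝ)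
    (RB : KZ.IntegralRep (n + 1)) (W : KZ.IntegralRep (n + 2)) (Ub Ua : KZ.IntegralRep (n + 1)),
    IsSemialgebraic ℚ τ → IsSemialgebraicFunOn ℚ τ a → IsSemialgebraicFunOn ℚ τ b →
    (∀ x ∈ τ, a x ≤ b x) →
    IsSemialgebraicFunOn ℚ (KZlog.band τ a b) H →
    IsSemialgebraicFunOn ℚ (KZlog.band τ a b) H' →
    IsSemialgebraicFunOn ℚ (KZlog.band τ a b) V →
    IsSemialgebraicFunOn ℚ (KZlog.band τ a b) P →
    (∀ z ∈ KZlog.band τ a b, 1 ≤ V z) →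
    (∀ x ∈ τ, ContinuousOn (fun t : ℝ => H (Fin.snoc x t)) (Icc (a x) (b x)) ∧
      ContinuousOn (fun t : ℝ => V (Fin.snoc x t)) (Icc (a x) (b x))) →
    (∀ x ∈ τ, ∀ t ∈ Ioo (a x) (b x),
      HasDerivAt (fun s : ℝ => H (Fin.snoc x s)) (H' (Fin.snoc x t)) t ∧
      HasDerivAt (fun s : ℝ => V (Fin.snoc x s)) (V' (Fin.snoc x t)) t) →
    (∀ x ∈ τ, ∀ t ∈ Ioo (a x) (b x),
      P (Fin.snoc x t) = H (Fin.snoc x t) * V' (Fin.snoc x t)) →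
    RB.domain = KZlog.band τ a b →
    EqOn RB.integrand (fun z => P z / V z) RB.domain →
    W.domain = KZlog.band (KZlog.band τ a b) (fun _ => 1) V →
    (∀ w ∈ W.domain, a (Fin.init (Fin.init w)) < Fin.init w (Fin.last n) →
      Fin.init w (Fin.last n) < b (Fin.init (Fin.init w)) →
      W.integrand w = H' (Fin.init w) / w (Fin.last (n + 1))) →
    Ub.domain = KZlog.band τ (fun _ => 1) (fun x => V (Fin.snoc x (b x))) →
    EqOn Ub.integrand (fun z => H (Fin.snoc (Fin.init z) (b (Fin.init z))) / z (Fin.last n))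
      Ub.domain →
    Ua.domain = KZlog.band τ (fun _ => 1) (fun x => V (Fin.snoc x (a x))) →
    EqOn Ua.integrand (fun z => -H (Fin.snoc (Fin.init z) (a (Fin.init z))) / z (Fin.last n))
      Ua.domain →
    KZ.of RB + KZ.of W - KZ.of Ub - KZ.of Ua ∈ KZ.relations

/-- **Shared support (cards A and B) — DEFOLDING integrability**, the converse of
`KZlog.IntegralRep.integrableOn_monomialIntegrand`: if the unfolded monomial `(x,u) ↦ h(x)/u` is
absolutely integrable on `{x ∈ σ, 1 ≤ u ≤ v x}` (pinned off a null set of the base), then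
`h · log v ∈ L¹(σ)` (Tonelli: `∫₁^v |h|/u du = |h| log v`; Mathlib
`MeasureTheory.Integrable.integral_norm_prod_right` after `volume_preserving_piFinSuccAbove`). -/
def DefoldIntegrable : Prop :=
  ∀ (n : ℕ) (σ N : Set (Fin n → ℝ)) (h v : (Fin n → ℝ) → ℝ) (g : (Fin (n + 1) → ℝ) → ℝ),
    IsSemialgebraic ℚ σ → IsSemialgebraicFunOn ℚ σ h → IsSemialgebraicFunOn ℚ σ v →
    (∀ x ∈ σ, 1 ≤ v x) → volume N = 0 →
    IntegrableOn g (KZlog.band σ (fun _ => 1) v) →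
    (∀ z ∈ KZlog.band σ (fun _ => 1) v, Fin.init z ∉ N →
      g z = h (Fin.init z) / z (Fin.last n)) →
    IntegrableOn (fun x => h x * Real.log (v x)) σ

/-- **Card B — first lemma: zero-extension of the definable fibre velocity.** From
`IsSemialgebraicFunOn.hasDerivAt_last_isSemialgebraic_holds` (BPR Prop. 3.22, proved in tree: `F'`
is `ℚ`-semialgebraic on the OPEN band) and `IsSemialgebraicFunOn.union` with `0` on the two
boundary graphs, a velocity `F''` semialgebraic on the CLOSED band and equal to `F'` on open
fibres — exactly the `hH'`/`hV'` hypothesis of the tree engine. -/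
def VelocityExtension : Prop :=
  ∀ (n : ℕ) (τ : Set (Fin n → ℝ)) (a b : (Fin n → ℝ) → ℝ) (F F' : (Fin (n + 1) → ℝ) → ℝ),
    IsSemialgebraic ℚ τ → IsSemialgebraicFunOn ℚ τ a → IsSemialgebraicFunOn ℚ τ b →
    IsSemialgebraicFunOn ℚ (KZlog.band τ a b) F →
    (∀ x ∈ τ, ∀ t ∈ Ioo (a x) (b x),
      HasDerivAt (fun s : ℝ => F (Fin.snoc x s)) (F' (Fin.snoc x t)) t) →
    ∃ F'' : (Fin (n + 1) → ℝ) → ℝ, IsSemialgebraicFunOn ℚ (KZlog.band τ a b) F'' ∧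
      ∀ x ∈ τ, ∀ t ∈ Ioo (a x) (b x),
        HasDerivAt (fun s : ℝ => F (Fin.snoc x s)) (F'' (Fin.snoc x t)) t

/-- **Card B — second lemma: null-normalisation congruence.** Two representations on the same
domain whose integrands agree off a null `ℚ`-semialgebraic set differ by a relation (rule 1a twice:
restrict to the good part — `KZ.of_sub_of_mem_relations_of_eqOn` — and to the null part —
`KZ.of_mem_relations_of_volume_eq_zero`). -/
def NullNormalise : Prop :=
  ∀ (n : ℕ) (r r' : KZ.IntegralRep n) (N : Set (Fin n → ℝ)),
    r'.domain = r.domain → IsSemialgebraic ℚ N → volume N = 0 →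
    EqOn r.integrand r'.integrand (r.domain \ N) →
    KZ.of r - KZ.of r' ∈ KZ.relations

/-! ### Two checked sanity lemmas for card A -/

/-- The `u = 1` slice of the band lies in the unfolded domain of `r₁` because `V ≥ 1`: this is what
lets card A READ `H'` off `r₁` (`H'' z := r₁.integrand (Fin.snoc z 1)`). -/
theorem snoc_one_mem_unfold {n : ℕ} {B : Set (Fin (n + 1) → ℝ)} {V : (Fin (n + 1) → ℝ) → ℝ}
    (hV1 : ∀ z ∈ B, 1 ≤ V z) {z : Fin (n + 1) → ℝ} (hz : z ∈ B) :
    (Fin.snoc z 1 : Fin (n + 2) → ℝ) ∈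
      {w : Fin (n + 2) → ℝ | Fin.init w ∈ B ∧ 1 ≤ w (Fin.last (n + 1)) ∧
        w (Fin.last (n + 1)) ≤ V (Fin.init w)} := by
  simp only [mem_setOf_eq, Fin.init_snoc, Fin.snoc_last, le_refl, true_and]
  exact ⟨hz, hV1 z hz⟩

/-- `P := r₄.integrand · V` recovers `r₄.integrand = P / V` on the whole band (no normalisation of
`r₄` is needed in card A) and equals `H · V'` wherever the crux pins `r₄`. -/
theorem P_div_V {n : ℕ} {B : Set (Fin (n + 1) → ℝ)} {g H V V' : (Fin (n + 1) → ℝ) → ℝ}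
    (hV1 : ∀ z ∈ B, 1 ≤ V z) :
    (∀ z ∈ B, g z = g z * V z / V z) ∧
      (∀ z ∈ B, g z = H z * V' z / V z → g z * V z = H z * V' z) := by
  refine ⟨fun z hz => ?_, fun z hz hg => ?_⟩
  · have : V z ≠ 0 := (one_pos.trans_le (hV1 z hz)).ne'
    field_simp
  · have : V z ≠ 0 := (one_pos.trans_le (hV1 z hz)).ne'
    rw [hg]
    field_simp


/-! ### Card A certified: the representation-form engine closes the crux (kernel-checked dictionary)

`RB := r₄`, `W := r₁`, `Ub := r₂`, `Ua := r₃.neg`, `H'' := r₁.integrand (·, 1)`,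
`P := r₄.integrand · V`; no normalisation, no velocity fact, no integrability bookkeeping. -/
theorem unfoldedLogStokes_of_engineOfReps (hE : EngineOfReps) :
    Summit.KontsevichZagierPeriods.KontsevichZagierPeriods.Theses.LiouvilleUnfolding.UnfoldedLogStokes := by
  intro n τ a b H H' V V' r₁ r₂ r₃ r₄ hτ ha hb hab hr₄d hH hV hV1 hcont hder hr₄i hr₁d hr₁i hr₂d hr₂i
    hr₃d hr₃i
  -- the band
  have hBeq : r₄.domain = KZlog.band τ a b := by rw [hr₄d]; rfl
  have hmemB : ∀ x ∈ τ, ∀ t ∈ Icc (a x) (b x), (Fin.snoc x t : Fin (n + 1) → ℝ) ∈ r₄.domain := by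
    intro x hx t ht
    rw [hBeq]
    exact KZlog.snoc_mem_band.2 ⟨hx, ht⟩
  have hV0 : ∀ z ∈ r₄.domain, V z ≠ 0 := fun z hz => (one_pos.trans_le (hV1 z hz)).ne'
  -- the `u = 1` slice of the band lies in `r₁.domain`
  have hslice : ∀ z ∈ r₄.domain, (Fin.snoc z 1 : Fin (n + 2) → ℝ) ∈ r₁.domain := by
    intro z hz
    rw [hr₁d]
    exact snoc_one_mem_unfold hV1 hz
  -- `H''` read off `r₁`
  set H'' : (Fin (n + 1) → ℝ) → ℝ := fun z => r₁.integrand (Fin.snoc z 1) with hH''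
  have hH''eq : ∀ z ∈ r₄.domain, a (Fin.init z) < z (Fin.last n) → z (Fin.last n) < b (Fin.init z) →
      H'' z = H' z := by
    intro z hz h1 h2
    have hw := hslice z hz
    have := hr₁i _ hw (by simpa using h1) (by simpa using h2)
    simpa [hH''] using this
  have hι : IsSemialgebraicMapOn ℚ r₄.domain (fun z => (Fin.snoc z (1 : ℝ) : Fin (n + 2) → ℝ)) := by
    refine IsSemialgebraicMapOn.of_forall r₄.isSemialgebraic_domain fun j => ?_
    refine Fin.lastCases ?_ (fun i => ?_) j
    · simpa only [Fin.snoc_last] using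
        (isSemialgebraicFunOn_ratCast r₄.isSemialgebraic_domain 1).congr fun _ _ => by simp
    · simpa only [Fin.snoc_castSucc] using isSemialgebraicFunOn_apply r₄.isSemialgebraic_domain i
  have hH''sa : IsSemialgebraicFunOn ℚ r₄.domain H'' :=
    IsSemialgebraicFunOn.comp_isSemialgebraicMapOn_holds r₁.isSemialgebraicFunOn_integrand hι
      (fun z hz => hslice z hz)
  -- `P` read off `r₄`
  set P : (Fin (n + 1) → ℝ) → ℝ := fun z => r₄.integrand z * V z with hP
  have hPsa : IsSemialgebraicFunOn ℚ r₄.domain P :=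
    IsSemialgebraicFunOn.mul_holds r₄.isSemialgebraicFunOn_integrand hV
  have hPeq : ∀ x ∈ τ, ∀ t ∈ Ioo (a x) (b x),
      P (Fin.snoc x t) = H (Fin.snoc x t) * V' (Fin.snoc x t) := by
    intro x hx t ht
    have hz := hmemB x hx t (Ioo_subset_Icc_self ht)
    have h := hr₄i _ hz (by simpa using ht.1) (by simpa using ht.2)
    simp only [hP, h]
    exact div_mul_cancel₀ _ (hV0 _ hz)
  have hRBi : EqOn r₄.integrand (fun z => P z / V z) r₄.domain := fun z hz => by
    simp only [hP]
    exact (mul_div_cancel_right₀ _ (hV0 z hz)).symm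
  -- fibre derivatives with `H''`
  have hder' : ∀ x ∈ τ, ∀ t ∈ Ioo (a x) (b x),
      HasDerivAt (fun s : ℝ => H (Fin.snoc x s)) (H'' (Fin.snoc x t)) t ∧
      HasDerivAt (fun s : ℝ => V (Fin.snoc x s)) (V' (Fin.snoc x t)) t := by
    intro x hx t ht
    rw [hH''eq _ (hmemB x hx t (Ioo_subset_Icc_self ht)) (by simpa using ht.1) (by simpa using ht.2)]
    exact hder x hx t ht
  -- domains and integrands of the four representations, in the engine's shape
  have hWd : r₁.domain = KZlog.band (KZlog.band τ a b) (fun _ => 1) V := by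
    rw [hr₁d, hBeq]
    rfl
  have hWi : ∀ w ∈ r₁.domain, a (Fin.init (Fin.init w)) < Fin.init w (Fin.last n) →
      Fin.init w (Fin.last n) < b (Fin.init (Fin.init w)) →
      r₁.integrand w = H'' (Fin.init w) / w (Fin.last (n + 1)) := by
    intro w hw h1 h2
    have hw' : Fin.init w ∈ r₄.domain := by
      rw [hr₁d] at hw
      exact hw.1
    rw [hr₁i w hw h1 h2, hH''eq _ hw' h1 h2]
  have hUbd : r₂.domain = KZlog.band τ (fun _ => 1) (fun x => V (Fin.snoc x (b x))) := by
    rw [hr₂d]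
    rfl
  have hUbi : EqOn r₂.integrand
      (fun z => H (Fin.snoc (Fin.init z) (b (Fin.init z))) / z (Fin.last n)) r₂.domain :=
    fun z hz => hr₂i z hz
  have hUad : r₃.neg.domain = KZlog.band τ (fun _ => 1) (fun x => V (Fin.snoc x (a x))) := by
    rw [KZ.IntegralRep.domain_neg, hr₃d]
    rfl
  have hUai : EqOn r₃.neg.integrand
      (fun z => -H (Fin.snoc (Fin.init z) (a (Fin.init z))) / z (Fin.last n)) r₃.neg.domain := by
    intro z hz
    rw [KZ.IntegralRep.domain_neg] at hz
    simp only [KZ.IntegralRep.integrand_neg, Pi.neg_apply, hr₃i z hz, neg_div]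
  -- the engine, then the sign of `r₃`
  have hH₁ : IsSemialgebraicFunOn ℚ (KZlog.band τ a b) H := hBeq ▸ hH
  have hH₂ : IsSemialgebraicFunOn ℚ (KZlog.band τ a b) H'' := hBeq ▸ hH''sa
  have hV₂ : IsSemialgebraicFunOn ℚ (KZlog.band τ a b) V := hBeq ▸ hV
  have hP₂ : IsSemialgebraicFunOn ℚ (KZlog.band τ a b) P := hBeq ▸ hPsa
  have hV1' : ∀ z ∈ KZlog.band τ a b, 1 ≤ V z := fun z hz => hV1 z (by rw [hBeq]; exact hz)
  have key := hE n τ a b H H'' V V' P r₄ r₁ r₂ r₃.neg hτ ha hb hab hH₁ hH₂ hV₂ hP₂ hV1' hcont hder'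
    hPeq hBeq hRBi hWd hWi hUbd hUbi hUad hUai
  have hneg : KZ.of r₃ + KZ.of r₃.neg ∈ KZ.relations :=
    KZ.levelRel_le_relations (KZ.of_add_of_neg_mem_levelRel r₃)
  have hsum : KZ.of r₁ - KZ.of r₂ + KZ.of r₃ + KZ.of r₄ =
      (KZ.of r₄ + KZ.of r₁ - KZ.of r₂ - KZ.of r₃.neg) + (KZ.of r₃ + KZ.of r₃.neg) := by abel
  rw [hsum]
  exact KZ.relations.add_mem key hneg


/-! ### Card B support lemmas, proved (de-risking): `NullNormalise` and `VelocityExtension` -/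

/-- `NullNormalise` holds: rule 1a) twice (restrict both representations to the good part and to
the null part), congruence on the good part, null-domain junk on the bad part. -/
theorem nullNormalise_holds : NullNormalise := by
  intro n r r' N hd hN hN0 h
  have hσ := r.isSemialgebraic_domain
  have hgood : IsSemialgebraic ℚ (r.domain \ N) := hσ.diff hN
  have hbad : IsSemialgebraic ℚ (r.domain ∩ N) := hσ.inter hN
  have hsub₁ : r.domain \ N ⊆ r'.domain := by rw [hd]; exact diff_subset
  have hsub₂ : r.domain ∩ N ⊆ r'.domain := by rw [hd]; exact inter_subset_left
  have hdec : r.domain = (r.domain \ N) ∪ (r.domain ∩ N) := (diff_union_inter _ _).symm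
  have hdisj : (r.domain \ N) ∩ (r.domain ∩ N) = ∅ := Set.disjoint_sdiff_inter.inter_eq
  have hnull : volume ((r.domain \ N) ∩ (r.domain ∩ N)) = 0 := by rw [hdisj, measure_empty]
  have h1 : KZ.of r - KZ.of (r.restrict _ hgood diff_subset) -
      KZ.of (r.restrict _ hbad inter_subset_left) ∈ KZ.relations := by
    refine KZ.domainAddRel_subset_relations ⟨n, r, r.restrict _ hgood diff_subset,
      r.restrict _ hbad inter_subset_left, ?_, ?_, fun _ _ => rfl, fun _ _ => rfl, rfl⟩
    · simpa only [KZ.IntegralRep.domain_restrict] using hdec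
    · simpa only [KZ.IntegralRep.domain_restrict] using hnull
  have h2 : KZ.of r' - KZ.of (r'.restrict _ hgood hsub₁) -
      KZ.of (r'.restrict _ hbad hsub₂) ∈ KZ.relations := by
    refine KZ.domainAddRel_subset_relations ⟨n, r', r'.restrict _ hgood hsub₁,
      r'.restrict _ hbad hsub₂, ?_, ?_, fun _ _ => rfl, fun _ _ => rfl, rfl⟩
    · simpa only [KZ.IntegralRep.domain_restrict, hd] using hdec
    · simpa only [KZ.IntegralRep.domain_restrict] using hnull
  have h3 : KZ.of (r.restrict _ hgood diff_subset) - KZ.of (r'.restrict _ hgood hsub₁) ∈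
      KZ.relations :=
    KZ.of_sub_of_mem_relations_of_eqOn rfl (fun x hx => h hx)
  have h4 : KZ.of (r.restrict _ hbad inter_subset_left) ∈ KZ.relations :=
    KZ.of_mem_relations_of_volume_eq_zero _ (measure_mono_null inter_subset_right hN0)
  have h5 : KZ.of (r'.restrict _ hbad hsub₂) ∈ KZ.relations :=
    KZ.of_mem_relations_of_volume_eq_zero _ (measure_mono_null inter_subset_right hN0)
  have key : KZ.of r - KZ.of r' =
      (KZ.of r - KZ.of (r.restrict _ hgood diff_subset) - KZ.of (r.restrict _ hbad inter_subset_left)) -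
      (KZ.of r' - KZ.of (r'.restrict _ hgood hsub₁) - KZ.of (r'.restrict _ hbad hsub₂)) +
      (KZ.of (r.restrict _ hgood diff_subset) - KZ.of (r'.restrict _ hgood hsub₁)) +
      KZ.of (r.restrict _ hbad inter_subset_left) - KZ.of (r'.restrict _ hbad hsub₂) := by abel
  rw [key]
  exact KZ.relations.sub_mem (KZ.relations.add_mem (KZ.relations.add_mem
    (KZ.relations.sub_mem h1 h2) h3) h4) h5

/-- `VelocityExtension` holds: BPR Prop. 3.22 in tree
(`IsSemialgebraicFunOn.hasDerivAt_last_isSemialgebraic_holds`) on the open band, extended by `0` over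
the two boundary graphs with `IsSemialgebraicFunOn.union`. -/
theorem velocityExtension_holds : VelocityExtension := by
  intro n τ a b F F' hτ ha hb hF hder
  classical
  -- the open band (in the fact's form) and the boundary graphs
  set O : Set (Fin (n + 1) → ℝ) := {z | Fin.init z ∈ τ ∧ a (Fin.init z) < z (Fin.last n) ∧
    z (Fin.last n) < b (Fin.init z)} with hO
  set Ga : Set (Fin (n + 1) → ℝ) := {z | Fin.init z ∈ τ ∧ z (Fin.last n) = a (Fin.init z)} with hGa
  set Gb : Set (Fin (n + 1) → ℝ) := {z | Fin.init z ∈ τ ∧ z (Fin.last n) = b (Fin.init z)} with hGb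
  set E : Set (Fin (n + 1) → ℝ) := KZlog.band τ a b ∩ (Ga ∪ Gb) with hE
  have hGa_sa : IsSemialgebraic ℚ Ga := isSemialgebraicFunOn_iff.mp ha
  have hGb_sa : IsSemialgebraic ℚ Gb := isSemialgebraicFunOn_iff.mp hb
  have hE_sa : IsSemialgebraic ℚ E := (KZlog.isSemialgebraic_band ha hb).inter (hGa_sa.union hGb_sa)
  have hF' : IsSemialgebraicFunOn ℚ O F' :=
    IsSemialgebraicFunOn.hasDerivAt_last_isSemialgebraic_holds n τ a b F F' ha hb hF hder
  -- the extension
  set F'' : (Fin (n + 1) → ℝ) → ℝ := fun z => if z ∈ O then F' z else 0 with hF''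
  have hfs : EqOn F'' F' O := fun z hz => by simp [hF'', hz]
  have hnot : ∀ z ∈ E, z ∉ O := by
    rintro z ⟨-, hz | hz⟩ hzO
    · exact (lt_irrefl _) (hz.2 ▸ hzO.2.1)
    · exact (lt_irrefl _) (hz.2 ▸ hzO.2.2)
  have hgt : EqOn F'' (fun _ => (0 : ℝ)) E := fun z hz => by simp [hF'', hnot z hz]
  have hzero : IsSemialgebraicFunOn ℚ E (fun _ => (0 : ℝ)) := by
    simpa using isSemialgebraicFunOn_ratCast hE_sa 0
  have hunion : IsSemialgebraicFunOn ℚ (O ∪ E) F'' := IsSemialgebraicFunOn.union hF' hzero hfs hgt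
  have hOE : O ∪ E = KZlog.band τ a b := by
    ext z
    simp only [hO, hE, hGa, hGb, KZlog.mem_band, mem_union, mem_inter_iff, mem_setOf_eq]
    constructor
    · rintro (⟨h1, h2, h3⟩ | ⟨h1, -⟩)
      · exact ⟨h1, h2.le, h3.le⟩
      · exact h1
    · rintro ⟨h1, h2, h3⟩
      rcases h2.lt_or_eq with h2' | h2'
      · rcases h3.lt_or_eq with h3' | h3'
        · exact Or.inl ⟨h1, h2', h3'⟩
        · exact Or.inr ⟨⟨h1, h2, h3⟩, Or.inr ⟨h1, h3'⟩⟩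
      · exact Or.inr ⟨⟨h1, h2, h3⟩, Or.inl ⟨h1, h2'.symm⟩⟩
  refine ⟨F'', hOE ▸ hunion, fun x hx t ht => ?_⟩
  have hmem : (Fin.snoc x t : Fin (n + 1) → ℝ) ∈ O := by
    simp only [hO, mem_setOf_eq, Fin.init_snoc, Fin.snoc_last]
    exact ⟨hx, ht.1, ht.2⟩
  rw [hfs hmem]
  exact hder x hx t ht


/-! ### Shared support lemma, proved (de-risking): `DefoldIntegrable` (Tonelli) -/

/-- `DefoldIntegrable` holds: Tonelli along the last coordinate
(`MeasureTheory.Integrable.integral_norm_prod_right` after `volume_preserving_piFinSuccAbove`), the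
fibre integral being `∫₁^v |h|/u du = |h| log v` (`KZlog.integral_div_Icc_one`). -/
theorem defoldIntegrable_holds : DefoldIntegrable := by
  intro n σ N h v g hσ hh hv hv1 hN0 hg hpin
  have hσm : MeasurableSet σ := IsSemialgebraic.measurableSet_holds hσ
  have hBsa : IsSemialgebraic ℚ (KZlog.band σ (fun _ => (1 : ℝ)) v) :=
    KZlog.isSemialgebraic_band (by simpa using isSemialgebraicFunOn_ratCast hσ 1) hv
  have hBm : MeasurableSet (KZlog.band σ (fun _ => (1 : ℝ)) v) := IsSemialgebraic.measurableSet_holds hBsa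
  -- the integrand extended by zero, and its transfer to `ℝ × ℝⁿ`
  set G : (Fin (n + 1) → ℝ) → ℝ := (KZlog.band σ (fun _ => (1 : ℝ)) v).indicator g with hG
  have hGint : Integrable G := (integrable_indicator_iff hBm).2 hg
  set e : (Fin (n + 1) → ℝ) ≃ᵐ ℝ × (Fin n → ℝ) :=
    MeasurableEquiv.piFinSuccAbove (fun _ => ℝ) (Fin.last n) with he_def
  have he : MeasurePreserving e volume volume :=
    volume_preserving_piFinSuccAbove (fun _ => ℝ) (Fin.last n)
  have he_symm : ∀ p : ℝ × (Fin n → ℝ), e.symm p = Fin.snoc p.2 p.1 := fun p => by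
    simp [he_def, MeasurableEquiv.piFinSuccAbove, Fin.snocEquiv]
  have hG2 : Integrable (fun p : ℝ × (Fin n → ℝ) => G (Fin.snoc p.2 p.1))
      ((volume : Measure ℝ).prod (volume : Measure (Fin n → ℝ))) := by
    have h := ((he.symm e).integrable_comp_emb e.symm.measurableEmbedding (g := G)).mpr hGint
    rw [← Measure.volume_eq_prod]
    convert h using 1
    ext p
    simp [he_symm]
  -- Tonelli: the fibre integrals of the norm are integrable
  have hnorm : Integrable (fun x : Fin n → ℝ => ∫ t : ℝ, ‖G (Fin.snoc x t)‖) := by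
    simpa using hG2.integral_norm_prod_right
  -- the fibre integral off `N` is `|h| log v`
  have hfib : ∀ x ∈ σ, x ∉ N → ∫ t : ℝ, ‖G (Fin.snoc x t)‖ = |h x| * Real.log (v x) := by
    intro x hx hxN
    have hfun : (fun t => ‖G (Fin.snoc x t)‖) = (Icc 1 (v x)).indicator (fun t => |h x| / t) := by
      ext t
      by_cases ht : t ∈ Icc 1 (v x)
      · have hmem : (Fin.snoc x t : Fin (n + 1) → ℝ) ∈ KZlog.band σ (fun _ => (1 : ℝ)) v :=
          KZlog.snoc_mem_band.2 ⟨hx, ht⟩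
        rw [indicator_of_mem ht, hG, indicator_of_mem hmem, hpin _ hmem (by simpa using hxN)]
        simp only [Fin.init_snoc, Fin.snoc_last, Real.norm_eq_abs, abs_div,
          abs_of_pos (one_pos.trans_le ht.1)]
      · rw [indicator_of_notMem ht, hG,
          indicator_of_notMem (fun hmem => ht (KZlog.snoc_mem_band.1 hmem).2), norm_zero]
    rw [hfun, integral_indicator measurableSet_Icc, KZlog.integral_div_Icc_one _ _ (hv1 x hx)]
  -- hence `|h| log v ∈ L¹(σ)`
  have hint_abs : IntegrableOn (fun x => |h x| * Real.log (v x)) σ := by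
    refine hnorm.integrableOn.congr_fun_ae ?_
    filter_upwards [ae_restrict_of_ae (compl_mem_ae_iff.2 hN0), ae_restrict_mem hσm] with x hxN hx
    exact hfib x hx hxN
  -- and `h log v ∈ L¹(σ)` (same norm, measurable)
  have hmeas : AEStronglyMeasurable (fun x => h x * Real.log (v x)) (volume.restrict σ) := by
    have h1 : AEStronglyMeasurable h (volume.restrict σ) :=
      KZ.aestronglyMeasurable_of_isSemialgebraicFunOn hh hσm
    have h2 : AEStronglyMeasurable v (volume.restrict σ) :=
      KZ.aestronglyMeasurable_of_isSemialgebraicFunOn hv hσm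
    exact h1.mul (Real.measurable_log.comp_aemeasurable h2.aemeasurable).aestronglyMeasurable
  refine Integrable.mono' hint_abs hmeas ?_
  filter_upwards [ae_restrict_mem hσm] with x hx
  rw [norm_mul, Real.norm_eq_abs, Real.norm_eq_abs, abs_of_nonneg (Real.log_nonneg (hv1 x hx))]


/-! ### Card B carried out: `EngineOfReps` from the tree engine VERBATIM (candidate full proof)

Velocity extension for `V`, null-normalisation of `RB` and `W` along the boundary graphs of `a`, `b`,
defolded integrability, boundary compositions, then `KZ.unfoldedLogStokes_mem_relations`. -/
theorem engineOfReps_holds : EngineOfReps := by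
  intro n τ a b H H' V V' P RB W Ub Ua hτ ha hb hab hH hH' hV hP hV1 hcont hder hPeq hRBd hRBi hWd
    hWi hUbd hUbi hUad hUai
  have hBsa : IsSemialgebraic ℚ (KZlog.band τ a b) := KZlog.isSemialgebraic_band ha hb
  have hBm : MeasurableSet (KZlog.band τ a b) := IsSemialgebraic.measurableSet_holds hBsa
  have hτm : MeasurableSet τ := IsSemialgebraic.measurableSet_holds hτ
  have hV0 : ∀ z ∈ KZlog.band τ a b, V z ≠ 0 := fun z hz => (one_pos.trans_le (hV1 z hz)).ne'
  have hmemB : ∀ x ∈ τ, ∀ t ∈ Icc (a x) (b x), (Fin.snoc x t : Fin (n + 1) → ℝ) ∈ KZlog.band τ a b :=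
    fun x hx t ht => KZlog.snoc_mem_band.2 ⟨hx, ht⟩
  -- (1) the definable velocity of `V`, extended to the closed band
  obtain ⟨V'', hV''sa, hderV''⟩ :=
    velocityExtension_holds n τ a b V V' hτ ha hb hV fun x hx t ht => (hder x hx t ht).2
  have hder'' : ∀ x ∈ τ, ∀ t ∈ Ioo (a x) (b x),
      HasDerivAt (fun s : ℝ => H (Fin.snoc x s)) (H' (Fin.snoc x t)) t ∧
      HasDerivAt (fun s : ℝ => V (Fin.snoc x s)) (V'' (Fin.snoc x t)) t :=
    fun x hx t ht => ⟨(hder x hx t ht).1, hderV'' x hx t ht⟩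
  have hV''eq : ∀ x ∈ τ, ∀ t ∈ Ioo (a x) (b x), V'' (Fin.snoc x t) = V' (Fin.snoc x t) :=
    fun x hx t ht => (hderV'' x hx t ht).unique (hder x hx t ht).2
  -- (2) the null boundary: graphs of `a` and `b` over `τ`
  set Nb : Set (Fin (n + 1) → ℝ) := {z | Fin.init z ∈ τ ∧ z (Fin.last n) = a (Fin.init z)} ∪
    {z | Fin.init z ∈ τ ∧ z (Fin.last n) = b (Fin.init z)} with hNb
  have hNb_sa : IsSemialgebraic ℚ Nb :=
    (isSemialgebraicFunOn_iff.mp ha).union (isSemialgebraicFunOn_iff.mp hb)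
  have hNb0 : volume Nb = 0 :=
    measure_union_null (KZ.volume_graph_eq_zero ha) (KZ.volume_graph_eq_zero hb)
  have hinterior : ∀ z ∈ KZlog.band τ a b, z ∉ Nb →
      a (Fin.init z) < z (Fin.last n) ∧ z (Fin.last n) < b (Fin.init z) := by
    intro z hz hzN
    simp only [hNb, mem_union, mem_setOf_eq, not_or, not_and] at hzN
    exact ⟨lt_of_le_of_ne hz.2.1 (fun h => hzN.1 hz.1 h.symm),
      lt_of_le_of_ne hz.2.2 (fun h => hzN.2 hz.1 h)⟩
  -- (3) `RB' = [band, H V''/V]`, a null modification of `RB`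
  have hRB'sa : IsSemialgebraicFunOn ℚ (KZlog.band τ a b) (fun z => H z * V'' z / V z) :=
    IsSemialgebraicFunOn.div (IsSemialgebraicFunOn.mul_holds hH hV''sa) hV hV0
  have hRB'eq : ∀ z ∈ KZlog.band τ a b, z ∉ Nb → RB.integrand z = H z * V'' z / V z := by
    intro z hz hzN
    obtain ⟨h1, h2⟩ := hinterior z hz hzN
    have hx : Fin.init z ∈ τ := hz.1
    have k1 := hPeq (Fin.init z) hx (z (Fin.last n)) ⟨h1, h2⟩
    have k2 := hV''eq (Fin.init z) hx (z (Fin.last n)) ⟨h1, h2⟩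
    simp only [Fin.snoc_init_self] at k1 k2
    rw [hRBi (show z ∈ RB.domain by rw [hRBd]; exact hz)]
    show P z / V z = H z * V'' z / V z
    rw [k1, k2]
  have hRB'int : IntegrableOn (fun z => H z * V'' z / V z) (KZlog.band τ a b) := by
    have h0 : IntegrableOn RB.integrand (KZlog.band τ a b) := hRBd ▸ RB.integrableOn
    refine h0.congr_fun_ae ?_
    filter_upwards [ae_restrict_of_ae (compl_mem_ae_iff.2 hNb0), ae_restrict_mem hBm] with z hzN hz
    exact hRB'eq z hz hzN
  let RB' : KZ.IntegralRep (n + 1) := ⟨KZlog.band τ a b, fun z => H z * V'' z / V z, hBsa, hRB'sa,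
    hRB'int⟩
  have hRBrel : KZ.of RB - KZ.of RB' ∈ KZ.relations :=
    nullNormalise_holds (n + 1) RB RB' Nb hRBd.symm hNb_sa hNb0
      fun z hz => hRB'eq z (by rw [← hRBd]; exact hz.1) hz.2
  -- (4) `W' = [W.domain, H'(init w)/u]`, a null modification of `W`
  have hWsa : IsSemialgebraic ℚ W.domain := W.isSemialgebraic_domain
  have hWm : MeasurableSet W.domain := IsSemialgebraic.measurableSet_holds hWsa
  have hW'sa : IsSemialgebraicFunOn ℚ W.domain (fun w => H' (Fin.init w) / w (Fin.last (n + 1))) := by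
    have hWB : W.domain ⊆ {w | Fin.init w ∈ KZlog.band τ a b} := by
      rw [hWd]; exact KZ.band_subset_setOf_init_mem
    have h1 : IsSemialgebraicFunOn ℚ W.domain (fun w => H' (Fin.init w)) := hH'.comp_init_mono hWsa hWB
    have h2 : IsSemialgebraicFunOn ℚ W.domain (fun w => 1 / w (Fin.last (n + 1))) :=
      (isSemialgebraicFunOn_aeval_div_aeval hWsa 1 (MvPolynomial.X (Fin.last (n + 1))) fun w hw => by
        rw [hWd] at hw
        simpa using (one_pos.trans_le hw.2.1).ne').congr fun w _ => by simp
    exact (IsSemialgebraicFunOn.mul_holds h1 h2).congr fun w _ => by simp [div_eq_mul_inv]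
  set Nw : Set (Fin (n + 2) → ℝ) := {w | Fin.init w ∈ Nb} with hNw
  have hNw_sa : IsSemialgebraic ℚ Nw := hNb_sa.setOf_init_mem
  have hNw0 : volume Nw = 0 := KZ.volume_setOf_init_mem_eq_zero hNb0
  have hW'eq : ∀ w ∈ W.domain, w ∉ Nw → W.integrand w = H' (Fin.init w) / w (Fin.last (n + 1)) := by
    intro w hw hwN
    have hw' : Fin.init w ∈ KZlog.band τ a b := by rw [hWd] at hw; exact hw.1
    obtain ⟨h1, h2⟩ := hinterior _ hw' hwN
    exact hWi w hw h1 h2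
  have hW'int : IntegrableOn (fun w => H' (Fin.init w) / w (Fin.last (n + 1))) W.domain := by
    refine W.integrableOn.congr_fun_ae ?_
    filter_upwards [ae_restrict_of_ae (compl_mem_ae_iff.2 hNw0), ae_restrict_mem hWm] with w hwN hw
    exact hW'eq w hw hwN
  let W' : KZ.IntegralRep (n + 2) := ⟨W.domain, fun w => H' (Fin.init w) / w (Fin.last (n + 1)), hWsa,
    hW'sa, hW'int⟩
  have hWrel : KZ.of W - KZ.of W' ∈ KZ.relations :=
    nullNormalise_holds (n + 2) W W' Nw rfl hNw_sa hNw0 fun w hw => hW'eq w hw.1 hw.2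
  -- (5) integrability, defolded from `W`, `Ub`, `Ua`
  have hintH' : IntegrableOn (fun z => H' z * Real.log (V z)) (KZlog.band τ a b) :=
    defoldIntegrable_holds (n + 1) (KZlog.band τ a b) Nb H' V W.integrand hBsa hH' hV hV1 hNb0
      (hWd ▸ W.integrableOn) fun w hw hwN => hW'eq w (by rw [hWd]; exact hw) hwN
  have hsnocMap : ∀ {c : (Fin n → ℝ) → ℝ}, IsSemialgebraicFunOn ℚ τ c →
      IsSemialgebraicMapOn ℚ τ (fun x => (Fin.snoc x (c x) : Fin (n + 1) → ℝ)) := by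
    intro c hc
    refine IsSemialgebraicMapOn.of_forall hτ fun j => ?_
    refine Fin.lastCases ?_ (fun i => ?_) j
    · simpa only [Fin.snoc_last] using hc
    · simpa only [Fin.snoc_castSucc] using isSemialgebraicFunOn_apply hτ i
  have hmapb : MapsTo (fun x => (Fin.snoc x (b x) : Fin (n + 1) → ℝ)) τ (KZlog.band τ a b) :=
    fun x hx => hmemB x hx _ ⟨hab x hx, le_rfl⟩
  have hmapa : MapsTo (fun x => (Fin.snoc x (a x) : Fin (n + 1) → ℝ)) τ (KZlog.band τ a b) :=
    fun x hx => hmemB x hx _ ⟨le_rfl, hab x hx⟩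
  have hHb : IsSemialgebraicFunOn ℚ τ fun x => H (Fin.snoc x (b x)) :=
    IsSemialgebraicFunOn.comp_isSemialgebraicMapOn_holds hH (hsnocMap hb) hmapb
  have hVb : IsSemialgebraicFunOn ℚ τ fun x => V (Fin.snoc x (b x)) :=
    IsSemialgebraicFunOn.comp_isSemialgebraicMapOn_holds hV (hsnocMap hb) hmapb
  have hHa : IsSemialgebraicFunOn ℚ τ fun x => H (Fin.snoc x (a x)) :=
    IsSemialgebraicFunOn.comp_isSemialgebraicMapOn_holds hH (hsnocMap ha) hmapa
  have hVa : IsSemialgebraicFunOn ℚ τ fun x => V (Fin.snoc x (a x)) :=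
    IsSemialgebraicFunOn.comp_isSemialgebraicMapOn_holds hV (hsnocMap ha) hmapa
  have hVb1 : ∀ x ∈ τ, 1 ≤ V (Fin.snoc x (b x)) := fun x hx => hV1 _ (hmapb hx)
  have hVa1 : ∀ x ∈ τ, 1 ≤ V (Fin.snoc x (a x)) := fun x hx => hV1 _ (hmapa hx)
  have hintb : IntegrableOn (fun x => H (Fin.snoc x (b x)) * Real.log (V (Fin.snoc x (b x)))) τ :=
    defoldIntegrable_holds n τ ∅ (fun x => H (Fin.snoc x (b x))) (fun x => V (Fin.snoc x (b x)))
      Ub.integrand hτ hHb hVb hVb1 measure_empty (hUbd ▸ Ub.integrableOn)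
      fun z hz _ => hUbi (by rw [hUbd]; exact hz)
  have hinta' : IntegrableOn (fun x => -H (Fin.snoc x (a x)) * Real.log (V (Fin.snoc x (a x)))) τ :=
    defoldIntegrable_holds n τ ∅ (fun x => -H (Fin.snoc x (a x))) (fun x => V (Fin.snoc x (a x)))
      Ua.integrand hτ hHa.neg hVa hVa1 measure_empty (hUad ▸ Ua.integrableOn)
      fun z hz _ => hUai (by rw [hUad]; exact hz)
  have hinta : IntegrableOn (fun x => H (Fin.snoc x (a x)) * Real.log (V (Fin.snoc x (a x)))) τ :=
    hinta'.neg.congr_fun (fun x _ => by simp [neg_mul]) hτm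
  -- (6) the tree engine, verbatim
  have key := KZ.unfoldedLogStokes_mem_relations hτ ha hb hab hH hH' hV hV''sa hV1 hcont hder''
    hRB'int hintH' hHb hVb hHa hVa hintb hinta RB' W' Ub Ua rfl (fun _ _ => rfl) hWd (fun _ _ => rfl)
    hUbd hUbi hUad hUai
  have hsum : KZ.of RB + KZ.of W - KZ.of Ub - KZ.of Ua =
      (KZ.of RB' + KZ.of W' - KZ.of Ub - KZ.of Ua) + (KZ.of RB - KZ.of RB') + (KZ.of W - KZ.of W') := by
    abel
  rw [hsum]
  exact KZ.relations.add_mem (KZ.relations.add_mem key hRBrel) hWrel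

/-- **Candidate full proof of the crux** (for the lead prover to land under
`Summits/KontsevichZagierPeriods/KontsevichZagierPeriods/Theorems/`): the representation-form engine
(card B's derivation from the tree engine) fed to card A's dictionary. -/
theorem unfoldedLogStokes_holds :
    Summit.KontsevichZagierPeriods.KontsevichZagierPeriods.Theses.LiouvilleUnfolding.UnfoldedLogStokes :=
  unfoldedLogStokes_of_engineOfReps engineOfReps_holds

/-- The crux, by name (checks that the route decl is in scope for the cards' dictionary). -/
example : Prop := Summit.KontsevichZagierPeriods.KontsevichZagierPeriods.Theses.LiouvilleUnfolding.UnfoldedLogStokes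

end Summit.KontsevichZagierPeriods.KontsevichZagierPeriods.Cruxes.UnfoldedLogStokes.Ideator2
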